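import Mathlib
import HarnessLib
import Summits.ValiantsHypothesis.ValiantsHypothesis.Theses.MonotoneRestoration
import Literature.Computability.AlgebraicComplexity.ArithCircuit
import Literature.Computability.AlgebraicComplexity.ArithCircuitProofs
import Literature.Computability.AlgebraicComplexity.MonotoneStructure
import Literature.Computability.AlgebraicComplexity.PermanentIrreducible
import Literature.ModelTheory.FiniteModelTheory.CkEquiv
import Summits.ValiantsHypothesis.ValiantsHypothesis.Theorems.MonotoneRestorationMonotoneRestorationQPCosetCount
import Summits.ValiantsHypothesis.ValiantsHypothesis.Theorems.MonotoneRestorationMonotoneRestorationQPSymmetricLB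
import Summits.ValiantsHypothesis.ValiantsHypothesis.Theorems.MonotoneRestorationMonotoneRestorationQPSupportSymmetrisation
import Summits.ValiantsHypothesis.ValiantsHypothesis.Theorems.MonotoneRestorationMonotoneRestorationQPSparseRegime
import Summits.ValiantsHypothesis.ValiantsHypothesis.Theorems.MonotoneRestorationMonotoneRestorationQPBeta
import Literature.Computability.AlgebraicComplexity.SymmetricArithCircuit
import Literature.Computability.AlgebraicComplexity.DawarWilsenach2025Proofs
import Literature.GroupTheory.PermutationGroups.SmallIndexSubgroups
import Summits.ValiantsHypothesis.ValiantsHypothesis.Theorems.MonotoneRestorationQP.Negative.LoadBearing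
import Summits.ValiantsHypothesis.ValiantsHypothesis.Theorems.MonotoneRestorationMonotoneRestorationQPPermSupportCount

/-! TTRL-lite variant V20074 of stmt-ValiantsHypothesis-15886 -/

-- `Summit.ValiantsHypothesis.ValiantsHypothesis.…` is the tree's mandated single-conjunct layout
-- (Sub = Summit), so the duplicated namespace component is intended.
set_option linter.dupNamespace false

namespace Summit.ValiantsHypothesis.ValiantsHypothesis.Theorems

open Summit.ValiantsHypothesis.ValiantsHypothesis.Theses.MonotoneRestoration
open Literature.Computability.AlgebraicComplexity

/-- TTRL-lite variant V20074 of `stub_symmetricMonotone_choose_le_card` (stmt-ValiantsHypothesis-15886):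
every monomial in the support of a finite product `∏ h ∈ s, p h` of multivariate polynomials splits as a
sum `∑ h ∈ s, ν h` of monomials `ν h ∈ (p h).support` of the factors (support of a product is contained
in the Minkowski sum of the supports, iterated over a `Finset`). -/
theorem stub_symmetricMonotone_choose_le_card_var20074 :
    ∀ (n : ℕ) (G : Type) (s : Finset G) (p : G → MvPolynomial (Fin n × Fin n) NNReal)
      (m : Fin n × Fin n →₀ ℕ), m ∈ (∏ h ∈ s, p h).support →
      ∃ ν : G → (Fin n × Fin n →₀ ℕ), (∀ h ∈ s, ν h ∈ (p h).support) ∧ m = ∑ h ∈ s, ν h := by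
  intro n G s p
  classical
  induction s using Finset.induction_on with
  | empty =>
    intro m hm
    refine ⟨fun _ => 0, fun h hh => absurd hh (Finset.notMem_empty h), ?_⟩
    rw [Finset.prod_empty] at hm
    rw [Finset.sum_empty]
    by_contra hne
    rw [MvPolynomial.mem_support_iff, MvPolynomial.coeff_one, if_neg (Ne.symm hne)] at hm
    exact hm rfl
  | insert a t hat ih =>
    intro m hm
    rw [Finset.prod_insert hat] at hm
    obtain ⟨m₁, hm₁, m₂, hm₂, rfl⟩ := Finset.mem_add.mp (MvPolynomial.support_mul _ _ hm)
    obtain ⟨ν', hν', rfl⟩ := ih m₂ hm₂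
    refine ⟨Function.update ν' a m₁, ?_, ?_⟩
    · intro h hh
      rcases Finset.mem_insert.mp hh with rfl | hh
      · simpa using hm₁
      · have hne : h ≠ a := fun he => hat (he ▸ hh)
        rw [Function.update_of_ne hne]
        exact hν' h hh
    · rw [Finset.sum_insert hat, Function.update_self]
      congr 1
      refine Finset.sum_congr rfl fun h hh => ?_
      have hne : h ≠ a := fun he => hat (he ▸ hh)
      rw [Function.update_of_ne hne]

end Summit.ValiantsHypothesis.ValiantsHypothesis.Theorems
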